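import Summits.BirchSwinnertonDyer.Rank1Residual.X5.TwoAdicTargetsAlphaAuto
import Summits.BirchSwinnertonDyer.Rank1Residual.X5.TwoAdicImageCriteriaLift
import Literature.NumberTheory.EllipticCurves.SkinnerUrban2014.PAdicUnitPeriodRatioAnyPrimeProofs
import Literature.NumberTheory.EllipticCurves.Rank1Residual.PeriodUnitProofs
import Literature.NumberTheory.EllipticCurves.NonEisensteinPrimeOfSurjective
import HarnessLib

/-!
# Route ByReductionTypeAtTwo, crux `OrdKatoHalfAtTwoIso` (stmt-BirchSwinnertonDyer-19573), line
# `steinberg-fibre-at-two` v2: SOCKET 4 (`stub_hint`, the `ϖ·L₂(f,α) ∈ ι(Λ)` currency) is PRINT BY NAME —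
# Abbes–Ullmo 1996 Thm. A (the Manin constant is prime to every prime of good reduction) ⇒ `HintOnDD12Residue`

Seat `cruxlead-stmt-BirchSwinnertonDyer-19573-g0` (LEAD PROVER, MODE LINE; HOME `run/shared/lean/pub/bsd-2adic/`).
HONEST FRAMING (cell bsd-2adic): BSD is not proved by any of this; the crux `OrdKatoHalfAtTwoIso` is NOT proved
here; nothing is booked. This file is KERNEL GLUE: it discharges the registered stub `stub_hint :
HintOnDD12Residue` of the line `Cruxes/OrdKatoHalfAtTwoIso/Lines/steinberg_fibre_at_two.lean` (socket 4: for
every residue curve `W` — non-CM, good ordinary at `2`, `ρ̄_{W,2}` onto, `ρ_{W,2^∞}` not onto —, its newform `f`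
at level `N_W` and every `ϖ ∈ ℚ` with `ϖ·Ω_W = Ω⁺_f`, an integral lift `L₀ ∈ Λ = ℤ₂⟦T⟧` of `ϖ·L₂(f, α)`)
MODULO ONE PUBLISHED FACT BY NAME, the tree's Literature named fact
`abbesUllmo_not_dvd_maninConstant_of_not_dvd_level` (Abbes–Ullmo 1996, Thm. A: `p ∤ N ⇒ p ∤ c` for the
`X₀(N)`-optimal curve; its content beyond Mazur 1978 Cor. 4.1 is exactly `p = 2`, `2 ∤ N`). Road (all tree
theorems): `L₂(f, α) ∈ ι(Λ)` for EVERY good-ordinary-at-`2` curve (INT2-AUTO,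
`exists_iwasawaToPowerSeries_eq_padicLFunction_two_auto`), so the content of the socket is `0 ≤ ord₂ ϖ`;
Abbes–Ullmo at the good prime `2` and odd-degree isogenies inside an `E[2]`-irreducible class give
`Ω_W = u·Ω⁺_f` with `‖u‖₂ = 1` (`realPeriodRat_eq_unit_mul_plusPeriod_two_of_abbesUllmo`, Greenberg–Vatsal 2000
§3 Remark 3.4), hence `ord₂ ϖ = 0` (`Rank1Residual.padicValRat_periodRatio_eq_zero_of_eq_unit_mul`) and
`L₀ = ϖ·G` (`X5.O1.exists_integral_mul_padicLFunction_two_of_padicValRat_nonneg`). The residue hypotheses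
`¬CM` and `ρ_{2^∞}` not onto are NOT used: the glue holds on the whole locus «good ordinary at `2`, `E[2]`
irreducible» (`hint_two_of_abbesUllmo_of_irr`); `hintOnDD12Residue_of_abbesUllmo` is the socket's VERBATIM
shape (the line's `def HintOnDD12Residue` unfolds to it by `Iff.rfl`; a Theorems file cannot import the
sorry-bearing line file, as for socket 3 / p642753).

Consequence for the line (lead's reshape v3): `stub_hint` (M, research-looking) becomes the cite-tier stub
`stub_AU : abbesUllmo_not_dvd_maninConstant_of_not_dvd_level` (PRINT BY NAME, never proved in the line) plus
this glue — the open content of the line is then exactly sockets 1–2 and the memo binders B7/B8.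

References: A. Abbes, E. Ullmo, Compositio Math. 103 (1996), Thm. A [AbbesUllmo1996]; R. Greenberg,
V. Vatsal, Invent. Math. 142 (2000), §3 Remark 3.4 [GreenbergVatsal2000]; B. Mazur, J. Tate, J. Teitelbaum,
Invent. Math. 84 (1986), §I.12 [MazurTateTeitelbaum1986Invent].
-/

set_option autoImplicit false
set_option linter.dupNamespace false

noncomputable section

open scoped Classical MatrixGroups ModularForm

open CongruenceSubgroup WeierstrassCurve Literature.NumberTheory.EllipticCurves
  Literature.NumberTheory.EllipticCurves.ModularForms
  Literature.NumberTheory.EllipticCurves.Rank1Residual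
  Literature.NumberTheory.EllipticCurves.SkinnerUrban2014
  Summit.BirchSwinnertonDyer.Rank1Residual.X5

namespace Summit.BirchSwinnertonDyer.BirchSwinnertonDyer.Theorems.SteinbergFibreAtTwo

/-- **`ord₂ ϖ = 0` on the locus «good reduction at `2`, `E[2]` irreducible», from Abbes–Ullmo by name**:
for every globally minimal elliptic `W/ℚ` with good reduction at `2` and `ρ̄_{W,2}` irreducible, every
newform `f` of `W` (any level) and every `ϖ ∈ ℚ` with `ϖ·Ω_W = Ω⁺_f`: `padicValRat 2 ϖ = 0`.
[cite: AbbesUllmo1996, Thm. A] [cite: GreenbergVatsal2000, §3, Remark 3.4] -/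
theorem padicValRat_two_periodRatio_eq_zero_of_abbesUllmo_of_irr
    (hAU : abbesUllmo_not_dvd_maninConstant_of_not_dvd_level) (W : WeierstrassCurve ℚ)
    [W.IsElliptic] [W.IsGloballyMinimal] (hgood : W.HasGoodReductionAtPrime 2)
    (hirr : W.HasIrreducibleModPGaloisRep 2) {N : ℕ} [NeZero N] (f : CuspForm (Gamma0 N) 2)
    (hf : IsNewformOf W f) (ϖ : ℚ) (hϖ : (ϖ : ℝ) * W.realPeriodRat = plusPeriod f) :
    padicValRat 2 ϖ = 0 := by
  obtain ⟨u, hu, hΩ⟩ := realPeriodRat_eq_unit_mul_plusPeriod_two_of_abbesUllmo hAU W hgood hirr f hf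
  exact Rank1Residual.padicValRat_periodRatio_eq_zero_of_eq_unit_mul W 2 f hu hΩ ϖ hϖ

/-- **The `hint` currency at `2` on «good ORDINARY at `2`, `E[2]` irreducible», from Abbes–Ullmo by name**:
for every such globally minimal `W`, every newform `f` of `W` and every `ϖ` with `ϖ·Ω_W = Ω⁺_f` there is
`L₀ ∈ Λ = ℤ₂⟦T⟧` with `ι L₀ = ϖ·L₂(f, α)` (`α` the unit root): `L₂(f,α) ∈ ι(Λ)` by INT2-AUTO and `ϖ ∈ ℤ₂`
by `padicValRat_two_periodRatio_eq_zero_of_abbesUllmo_of_irr`.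
[cite: AbbesUllmo1996, Thm. A] [cite: MazurTateTeitelbaum1986Invent, §I.12] -/
theorem hint_two_of_abbesUllmo_of_irr
    (hAU : abbesUllmo_not_dvd_maninConstant_of_not_dvd_level) (W : WeierstrassCurve ℚ)
    [W.IsElliptic] [W.IsGloballyMinimal] (hgo : GoodOrd W 2) (hirr : W.HasIrreducibleModPGaloisRep 2)
    {N : ℕ} [NeZero N] (f : CuspForm (Gamma0 N) 2) (hf : IsNewformOf W f) (ϖ : ℚ)
    (hϖ : (ϖ : ℝ) * W.realPeriodRat = plusPeriod f) :
    ∃ L₀ : IwasawaAlgebra 2, iwasawaToPowerSeries 2 L₀ =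
      PowerSeries.C (ϖ : ℚ_[2]) * padicLFunction f (unitRoot W 2 : ℚ_[2]) :=
  O1.exists_integral_mul_padicLFunction_two_of_padicValRat_nonneg W ⟨hgo.1, hgo.2⟩ hf
    (padicValRat_two_periodRatio_eq_zero_of_abbesUllmo_of_irr hAU W hgo.1 hirr f hf ϖ hϖ).ge

/-- **SOCKET 4 of line `steinberg-fibre-at-two` from Abbes–Ullmo BY NAME** — VERBATIM the body of the line's
`HintOnDD12Residue` (crux `OrdKatoHalfAtTwoIso`, stmt-BirchSwinnertonDyer-19573): for every non-CM globally
minimal `W`, good ordinary at `2`, `ρ̄_{W,2}` onto (hence `E[2]` irreducible, Serre §4 —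
`hasIrreducibleModPGaloisRep_of_hasSurjectiveModNGaloisRep`), `ρ_{W,2^∞}` not onto, its newform `f` at level
`N_W` and every `ϖ` with `ϖ·Ω_W = Ω⁺_f`: `ϖ·L₂(f,α) ∈ ι(Λ)`. The hypotheses `¬CM` and `¬TwoAdicSurjective`
are idle (kept for the verbatim shape). [cite: AbbesUllmo1996, Thm. A] [cite: MazurTateTeitelbaum1986Invent, §I.12] -/
theorem hintOnDD12Residue_of_abbesUllmo (hAU : abbesUllmo_not_dvd_maninConstant_of_not_dvd_level) :
    ∀ (W : WeierstrassCurve ℚ) [W.IsElliptic] [W.IsGloballyMinimal],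
      ¬ W.HasCM → GoodOrd W 2 → W.HasSurjectiveModNGaloisRep 2 → ¬ O1.TwoAdicSurjective W →
      ∀ [NeZero (W.conductorNorm ℤ)] (f : CuspForm (Gamma0 (W.conductorNorm ℤ)) 2),
        IsNewformOf W f → ∀ ϖ : ℚ, (ϖ : ℝ) * W.realPeriodRat = plusPeriod f →
          ∃ L₀ : IwasawaAlgebra 2, iwasawaToPowerSeries 2 L₀ =
            PowerSeries.C (ϖ : ℚ_[2]) * padicLFunction f (unitRoot W 2 : ℚ_[2]) := by
  intro W _ _ _ hgo h2 _ _ f hf ϖ hϖ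
  haveI : NeZero ((2 : ℕ) : ℚ) := ⟨by norm_num⟩
  exact hint_two_of_abbesUllmo_of_irr hAU W hgo
    (hasIrreducibleModPGaloisRep_of_hasSurjectiveModNGaloisRep W 2 h2) f hf ϖ hϖ

end Summit.BirchSwinnertonDyer.BirchSwinnertonDyer.Theorems.SteinbergFibreAtTwo

end
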